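import Summits.QuantumFields.YangMills.Theorems.FluctuationComparisonRegPrIntLS2BetaPeanoSmooth
import Summits.QuantumFields.YangMills.Theorems.FluctuationComparisonRegPrIntLS2BetaPivotResolveParam
import HarnessLib

/-!
# S2β · LAPLACE row — (C2″): JOINT SMOOTHNESS OF `(s, y) ↦ A(c.Φ(x s, σ y))` AT A SHIFTED BASE POINT OF THE COMMON TUBE, ALONG A SMOOTH PATH OF DATA (pen w5-20520 g14)

Cell `ym3-torus` (rung R3: continuum `SU(2)` Yang–Mills on `T³` — NOT `d = 4`, NOT infinite volume, NOT a mass gap, NOT Clay); width seat `ym-ust-20520-w5` g14;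
helper of the crux `stmt-QuantumFields-20520` (`--supports`, NOT a proof of it).  THEOREMS ONLY (0 `def`, 0 `sorry`; default heartbeats).

WHY (v11 DET-REP-A of LINE g18-1: ✓`…DetRepAEdge.detRepA_edge` (p748815) DISPLAYS the row `ContDiffAt ℝ 3 (fun q : ℝ × E => A(c.Φ(x q.1, σ q.2))) (s, y s)` — joint
smoothness of the action through the window chart at the MOVING datum `x s` and the SHIFTED transversal point `σ (y s)`; ✓(C2-d) `…PeanoSmooth.contDiffAt_wilsonAction4_windowChart`
gives it only at a fixed datum and at the base point `σ 0 = U₀` of the tube).  THIS FILE supplies that row from ✓(C2′) `…PivotResolveParam.contDiffAt_wilsonAction4_resolve_param`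
(p744240): parameter `p = (s, v) ∈ ℝ × E`, moving coarse target `T p := fieldShift⁻¹ (x (s₀ + s))`, the transversal RE-CENTRED at the charted field
`U₁ := c.Φ(x s₀, σ y₁)` by overwriting the pivots of `σ (y₁ + v)` with those of `U₁` (the chart is PIVOT-BLIND, CHART∞ clause `hΦbl`, so the action is unchanged),
px11's (C2-b) blocks at `U₁` (✓`isInvertible_fderiv_chainRead`, `U₁ ∈ histGood` ⇒ small loop history), then translation back to `(s₀, y₁)`.

WHAT.  ★★★ `contDiffAt_wilsonAction4_windowChart_param` — hypotheses: the §1 regime of ✓PeanoSmooth (`hα24 hαδ hαL`, `hθ0 hθα`); a smooth path of data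
`s ↦ x s` (matrix field `C^∞` at `s₀`, continuous); the tube transversal `σ` (continuous, `C^∞` matrix field); the CHART clauses at every datum (descent on the carrier,
off-pivot agreement, `Φ` pivot-blind, `jac` pivot-blind — ✓`exists_laplaceRows` clauses 1, 8, 6, 5); the base data: `U₁ = c.Φ(x s₀, σ y₁) ∈ histGood`, `descendTo U₁ = x s₀`,
`c.Φ(x s₀, U₁) = U₁` (recognition, clause 7), live base `c.jac (x s₀, σ y₁) ≠ 0`, the path stays in the carriers near `(s₀, y₁)`, and JOINT continuity of `c.Φ` at
`(x s₀, U₁)` (CHART∞ II∕IV; displayed).  Conclusion: `ContDiffAt ℝ m (fun q : ℝ × E => wilsonAction4 (c.Φ (x q.1, σ q.2))) (s₀, y₁)`.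

HONEST SCOPE.  Implicit-function assembly over landed letters; proves no stub; EXW ∕ GAP♯ ∕ FOUR-POINT-DECAY ∕ LAPLACE ∕ S2β ∕ the crux 20520 NOT proved; `YM3TorusSU2` NOT proved;
the Yang–Mills mass gap (Clay) NOT proved.

References: [Balaban1987RG1] CMP 109 (1987) (0.4) p. 253, p. 267; [Balaban1985Variational] CMP 102 (1985) Thm 1 (8)–(10) p. 279; [Dieudonne1960] Ch. X §2 (10.2.1)–(10.2.3).
-/

noncomputable section

open scoped Matrix.Norms.L2Operator Topology ContDiff
open Filter Set Function
open Literature.MathematicalPhysics.QuantumFieldTheory.Balaban1983to89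
open Literature.MathematicalPhysics.QuantumFieldTheory.Balaban1983to89.HaarExponentialChart
open Literature.MathematicalPhysics.QuantumFieldTheory.Balaban1983to89.HaarExponentialChart.IsChartRep
open Literature.MathematicalPhysics.QuantumFieldTheory.Balaban1983to89.BlockAveraging (Small Idx avgFun loopHol blockAvg blockAvg_avg)
open Literature.MathematicalPhysics.QuantumFieldTheory.Balaban1983to89.ExpMeanLog (expMeanLogSU deltaSU deltaSU_pos)
open Literature.MathematicalPhysics.QuantumFieldTheory.Balaban1983to89.Node00
open Literature.MathematicalPhysics.QuantumFieldTheory.Balaban1983to89.T3ContinuumYM3Torus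
open Literature.MathematicalPhysics.QuantumFieldTheory.Balaban1983to89.T3UnitLawDensityEML
open Literature.MathematicalPhysics.QuantumFieldTheory.Balaban1983to89.T3UnitScaleTilt
open Literature.MathematicalPhysics.QuantumFieldTheory.Balaban1983to89.T3TiltDescent
open Literature.MathematicalPhysics.QuantumFieldTheory.Balaban1983to89.T3LevelShift
open Literature.MathematicalPhysics.QuantumFieldTheory.Balaban1983to89.T3Thresholds
open Summit.QuantumFields.YangMills.Theorems.FluctuationComparisonRegPrIntLWregGlue
open Summit.QuantumFields.YangMills.Theorems.FluctuationComparisonRegPrIntLWregChain (iterCentralBond iterCentralBond_injective chainMap)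
open Summit.QuantumFields.YangMills.Theorems.FluctuationComparisonRegPrIntLS2BetaPivotReadSmooth
open Summit.QuantumFields.YangMills.Theorems.FluctuationComparisonRegPrIntLS2BetaPivotResolveSmooth
open Summit.QuantumFields.YangMills.Theorems.FluctuationComparisonRegPrIntLS2BetaPivotResolveParam
open Summit.QuantumFields.YangMills.Theorems.FluctuationComparisonRegPrIntLS2BetaChainDerivative
open Summit.QuantumFields.YangMills.Theorems.FluctuationComparisonRegPrIntLS2BetaPeanoSmooth

namespace Summit.QuantumFields.YangMills.Theorems.FluctuationComparisonRegPrIntLS2BetaPeanoSmoothParam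

variable (F : T3Family) {J K : ℕ} (hJK : J ≤ K) {dV : ℕ}

/-- ★★★ **(C2″) JOINT SMOOTHNESS AT A SHIFTED BASE POINT ALONG A SMOOTH PATH OF DATA.**  See the module docstring for the hypotheses; conclusion:
`(s, y) ↦ A(c.Φ(x s, σ y))` is `C^m` at `(s₀, y₁)` — the `ContDiffAt ℝ 3` row of ✓`detRepA_edge`, for every `m`.
[cite: Balaban1987RG1, p.267 (after (2.10))] [cite: Balaban1985Variational, Thm 1 (8)-(10) p.279] [cite: Dieudonne1960, Ch. X §2 (10.2.1)–(10.2.3)] -/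
theorem contDiffAt_wilsonAction4_windowChart_param (hk : K - J ≤ (F.P K).m + (F.P K).K) {α : ℝ} (hα24 : α ≤ 1 / 24) (hαδ : α < deltaSU (Fin 2))
    (hαL : 157 * α < ((((F.P K).L : ℕ) : ℝ) ^ ((F.P K).d - 1))⁻¹) {θ : ℕ → ℝ} (hθ0 : ∀ i, 0 ≤ θ i)
    (hθα : ∀ i, ((((F.P K).d + 2) * (F.P K).L : ℕ) : ℝ) ^ 2 / 4 * θ i ≤ α)
    {Sf : Set (GaugeField (F.P K) 0 (Matrix.specialUnitaryGroup (Fin 2) ℂ))} {O : Set (GaugeField (F.P J) 0 (Matrix.specialUnitaryGroup (Fin 2) ℂ))}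
    (c : WindowChart F hJK Sf O)
    -- the smooth path of data
    (x : ℝ → GaugeField (F.P J) 0 (Matrix.specialUnitaryGroup (Fin 2) ℂ)) (s₀ : ℝ) (hxc : ContinuousAt x s₀)
    (hxs : ContDiffAt ℝ ⊤ (fun s => coeField (x s)) s₀)
    -- the transversal of the common tube
    (σ : EuclideanSpace ℝ (Fin dV) → GaugeField (F.P K) 0 (Matrix.specialUnitaryGroup (Fin 2) ℂ)) (hσc : Continuous σ)
    (hσs : ContDiff ℝ ⊤ (fun y : EuclideanSpace ℝ (Fin dV) => coeField (σ y))) (y₁ : EuclideanSpace ℝ (Fin dV))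
    -- chart clauses at every datum (✓`exists_laplaceRows` 1, 8, 6, 5)
    (hdesc : ∀ V z, c.jac (V, z) ≠ 0 → descendTo F ℰp J K hJK (c.Φ (V, z)) = V)
    (hoff : ∀ V z, c.jac (V, z) ≠ 0 → ∀ b, (∀ c', iterCentralBond (K - J) c' ≠ b) → c.Φ (V, z) b = z b)
    (hΦbl : ∀ V z (g : PBond (F.P K) (K - J) → Matrix.specialUnitaryGroup (Fin 2) ℂ), c.jac (V, z) ≠ 0 →
      c.Φ (V, Function.extend (iterCentralBond (K - J)) g z) = c.Φ (V, z))
    (hjbl : ∀ V z (g : PBond (F.P K) (K - J) → Matrix.specialUnitaryGroup (Fin 2) ℂ), c.jac (V, Function.extend (iterCentralBond (K - J)) g z) = c.jac (V, z))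
    -- the base data at `(s₀, y₁)`
    {U₁ : GaugeField (F.P K) 0 (Matrix.specialUnitaryGroup (Fin 2) ℂ)} (hU₁ : c.Φ (x s₀, σ y₁) = U₁) (hU₁h : U₁ ∈ histGood F ℰp θ K J)
    (hselfU₁ : c.Φ (x s₀, U₁) = U₁) (hlive : c.jac (x s₀, σ y₁) ≠ 0)
    (hcarrier : ∀ᶠ q in 𝓝 ((s₀ : ℝ), y₁), c.jac (x q.1, σ q.2) ≠ 0)
    (hΦjc : ContinuousAt (fun q : GaugeField (F.P J) 0 (Matrix.specialUnitaryGroup (Fin 2) ℂ) × GaugeField (F.P K) 0 (Matrix.specialUnitaryGroup (Fin 2) ℂ) => c.Φ q)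
      (x s₀, U₁))
    (m : WithTop ℕ∞) :
    ContDiffAt ℝ m (fun q : ℝ × EuclideanSpace ℝ (Fin dV) => wilsonAction4 (c.Φ (x q.1, σ q.2))) (s₀, y₁) := by
  classical
  set β := iterCentralBond (P := F.P K) (K - J) with hβ
  have hβi : Function.Injective β := iterCentralBond_injective (P := F.P K) hk
  -- descent of `U₁` and its guard
  have hU₁V : descendTo F ℰp J K hJK U₁ = x s₀ := by rw [← hU₁]; exact hdesc _ _ hlive
  have hhist := loopHist_le_of_mem_histGood F hθ0 hθα hU₁h
  have hU₁small : SmallBelow (fun j => blockAvg (P := F.P K) (j := j) (expMeanLogSU (n := Fin 2))) (K - J) U₁ := smallBelow_of_loopHist_le hαδ hhist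
  -- `U₁` agrees with `σ y₁` off the pivots
  have hU₁off : ∀ b, (∀ c', β c' ≠ b) → U₁ b = σ y₁ b := fun b hb => by rw [← hU₁]; exact hoff _ _ hlive b hb
  -- the re-centred transversal family `σ̂ p := (σ (y₁ + p.2)) with the pivots of U₁`
  set σh : ℝ × EuclideanSpace ℝ (Fin dV) → GaugeField (F.P K) 0 (Matrix.specialUnitaryGroup (Fin 2) ℂ) :=
    fun p => Function.extend β (fun c' => U₁ (β c')) (σ (y₁ + p.2)) with hσh
  have hσh_piv : ∀ p c', σh p (β c') = U₁ (β c') := fun p c' => hβi.extend_apply _ _ c'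
  have hσh_off : ∀ p b, (¬ ∃ c', β c' = b) → σh p b = σ (y₁ + p.2) b := fun p b hb => Function.extend_apply' _ _ b hb
  have hσh0 : σh 0 = U₁ := by
    show Function.extend β (fun c' => U₁ (β c')) (σ (y₁ + (0 : ℝ × EuclideanSpace ℝ (Fin dV)).2)) = U₁
    rw [Prod.snd_zero, add_zero]
    exact extend_pivots_eq_of_offPivot β hU₁off
  have hσhc : Continuous σh := by
    refine continuous_pi fun b => ?_
    by_cases hb : ∃ c', β c' = b
    · obtain ⟨c', rfl⟩ := hb
      simp only [hσh_piv]; exact continuous_const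
    · simp only [hσh_off _ b hb]
      exact (continuous_apply b).comp (hσc.comp (continuous_const.add continuous_snd))
  have hσhs : ContDiffAt ℝ ⊤ (fun p => coeField (σh p)) 0 := by
    refine contDiffAt_pi.2 fun b => ?_
    by_cases hb : ∃ c', β c' = b
    · obtain ⟨c', rfl⟩ := hb
      have : (fun p : ℝ × EuclideanSpace ℝ (Fin dV) => coeField (σh p) (β c')) = fun _ => ((U₁ (β c') : Matrix.specialUnitaryGroup (Fin 2) ℂ) : Matrix (Fin 2) (Fin 2) ℂ) := by
        funext p; simp only [coeField, hσh_piv]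
      rw [this]; exact contDiffAt_const
    · have : (fun p : ℝ × EuclideanSpace ℝ (Fin dV) => coeField (σh p) b) = fun p => coeField (σ (y₁ + p.2)) b := by
        funext p; simp only [coeField, hσh_off _ b hb]
      rw [this]
      have h1 : ContDiffAt ℝ ⊤ (fun p : ℝ × EuclideanSpace ℝ (Fin dV) => coeField (σ (y₁ + p.2))) 0 :=
        hσs.contDiffAt.comp 0 (contDiffAt_const.add contDiffAt_snd)
      exact (contDiffAt_pi.1 h1) b
  -- the moving coarse target
  set eJ := F.sitesPerDir_eq (m := F.m) (K := J) (j := 0) (m' := F.m) (K' := K) (j' := K - J) (by omega) with heJ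
  set T : ℝ × EuclideanSpace ℝ (Fin dV) → GaugeField (F.P K) (K - J) (Matrix.specialUnitaryGroup (Fin 2) ℂ) :=
    fun p => fieldShift eJ.symm (x (s₀ + p.1)) with hT
  have hiter_of_desc : ∀ U : GaugeField (F.P K) 0 (Matrix.specialUnitaryGroup (Fin 2) ℂ), ∀ V, descendTo F ℰp J K hJK U = V →
      Averaging.iter (fun j => blockAvg (P := F.P K) (j := j) (expMeanLogSU (n := Fin 2))) (K - J) U = fieldShift eJ.symm V := by
    intro U V h
    unfold descendTo at h
    rw [← h, fieldShift_fieldShift_symm]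
  have hT0 : T 0 = Averaging.iter (fun j => blockAvg (P := F.P K) (j := j) (expMeanLogSU (n := Fin 2))) (K - J) U₁ := by
    show fieldShift eJ.symm (x (s₀ + (0 : ℝ × EuclideanSpace ℝ (Fin dV)).1)) = _
    rw [Prod.fst_zero, add_zero, hiter_of_desc U₁ (x s₀) hU₁V]
  have hTs : ContDiffAt ℝ ⊤ (fun p => coeField (T p)) 0 := by
    have hx' : ContDiffAt ℝ ⊤ (fun p : ℝ × EuclideanSpace ℝ (Fin dV) => coeField (x (s₀ + p.1))) 0 := by
      have h0 : ContDiffAt ℝ ⊤ (fun s => coeField (x s)) (s₀ + (0 : ℝ × EuclideanSpace ℝ (Fin dV)).1) := by rw [Prod.fst_zero, add_zero]; exact hxs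
      exact ContDiffAt.comp (g := fun s => coeField (x s)) (f := fun p : ℝ × EuclideanSpace ℝ (Fin dV) => s₀ + p.1) 0 h0
        (contDiffAt_const.add contDiffAt_fst)
    refine contDiffAt_pi.2 fun b => ?_
    have : (fun p : ℝ × EuclideanSpace ℝ (Fin dV) => coeField (T p) b) = fun p => coeField (x (s₀ + p.1)) (bondShift eJ.symm b) := by
      funext p; simp only [coeField, hT, fieldShift_apply]
    rw [this]; exact (contDiffAt_pi.1 hx') _
  -- the family of charts
  set Φh : ℝ × EuclideanSpace ℝ (Fin dV) → GaugeField (F.P K) 0 (Matrix.specialUnitaryGroup (Fin 2) ℂ) → GaugeField (F.P K) 0 (Matrix.specialUnitaryGroup (Fin 2) ℂ) :=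
    fun p z => c.Φ (x (s₀ + p.1), z) with hΦh
  -- the path stays live, also after re-centring (jac is pivot-blind)
  have ht0 : Tendsto (fun p : ℝ × EuclideanSpace ℝ (Fin dV) => ((s₀ + p.1 : ℝ), y₁ + p.2)) (𝓝 0) (𝓝 (s₀, y₁)) := by
    have h := ((continuous_const.add continuous_fst).prodMk (continuous_const.add continuous_snd) :
      Continuous fun p : ℝ × EuclideanSpace ℝ (Fin dV) => ((s₀ + p.1 : ℝ), y₁ + p.2)).tendsto 0
    simpa using h
  have hlive' : ∀ᶠ p in 𝓝 (0 : ℝ × EuclideanSpace ℝ (Fin dV)), c.jac (x (s₀ + p.1), σ (y₁ + p.2)) ≠ 0 := ht0.eventually hcarrier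
  have hliveh : ∀ᶠ p in 𝓝 (0 : ℝ × EuclideanSpace ℝ (Fin dV)), c.jac (x (s₀ + p.1), σh p) ≠ 0 := by
    filter_upwards [hlive'] with p hp
    rwa [hσh, hjbl]
  -- (C2′) rows
  have hoff' : ∀ᶠ p in 𝓝 (0 : ℝ × EuclideanSpace ℝ (Fin dV)), ∀ b, (∀ c', iterCentralBond (K - J) c' ≠ b) → Φh p (σh p) b = σh p b := by
    filter_upwards [hliveh] with p hp b hb
    exact hoff _ _ hp b hb
  have hfib' : ∀ᶠ p in 𝓝 (0 : ℝ × EuclideanSpace ℝ (Fin dV)),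
      Averaging.iter (fun j => blockAvg (P := F.P K) (j := j) (expMeanLogSU (n := Fin 2))) (K - J) (Φh p (σh p)) = T p := by
    filter_upwards [hliveh] with p hp
    exact hiter_of_desc _ _ (hdesc _ _ hp)
  have hΦc' : ContinuousAt (fun p => Φh p (σh p)) 0 := by
    have hin : ContinuousAt (fun p : ℝ × EuclideanSpace ℝ (Fin dV) => (x (s₀ + p.1), σh p)) 0 := by
      refine ContinuousAt.prodMk ?_ hσhc.continuousAt
      have hx0 : ContinuousAt x (s₀ + (0 : ℝ × EuclideanSpace ℝ (Fin dV)).1) := by rw [Prod.fst_zero, add_zero]; exact hxc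
      exact ContinuousAt.comp (f := fun p : ℝ × EuclideanSpace ℝ (Fin dV) => s₀ + p.1) hx0 (continuousAt_const.add continuousAt_fst)
    have hbase : (fun p : ℝ × EuclideanSpace ℝ (Fin dV) => (x (s₀ + p.1), σh p)) 0 = (x s₀, U₁) := by
      show (x (s₀ + (0 : ℝ × EuclideanSpace ℝ (Fin dV)).1), σh 0) = _
      rw [Prod.fst_zero, add_zero, hσh0]
    have hΦjc' := hΦjc
    rw [← hbase] at hΦjc'
    exact ContinuousAt.comp hΦjc' hin
  have hself' : Φh 0 U₁ = U₁ := by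
    show c.Φ (x (s₀ + (0 : ℝ × EuclideanSpace ℝ (Fin dV)).1), U₁) = U₁
    rw [Prod.fst_zero, add_zero]; exact hselfU₁
  -- (C2-b) blocks at `U₁`
  have hR := contDiffAt_pivotRead_param (n := K - J) U₁ hU₁small σh hσhc hσh0 hσhs T hT0 hTs
  have hinv := isInvertible_inr_param_of_blocks hk U₁ σh hσh0 T hT0 (hR.differentiableAt (by simp))
    (fun c' => ((chainRead_contDiffAt_surjective (P := F.P K) (N := 2) hα24 hαδ hαL hk U₁ c' hhist).2.1.differentiableAt (by simp)))
    (fun c' => isInvertible_fderiv_chainRead (P := F.P K) (N := 2) hα24 hαδ hαL hk U₁ c' hhist)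
  -- (C2′)
  have hmain := contDiffAt_wilsonAction4_resolve_param (n := K - J) U₁ hU₁small σh hσhc hσh0 hσhs T hT0 hTs Φh hoff' hfib' hΦc' hself' hinv m
  -- undo the re-centring (the chart is pivot-blind) and translate to `(s₀, y₁)`
  have heq : (fun p : ℝ × EuclideanSpace ℝ (Fin dV) => wilsonAction4 (Φh p (σh p))) =ᶠ[𝓝 0]
      fun p => wilsonAction4 (c.Φ (x (s₀ + p.1), σ (y₁ + p.2))) := by
    filter_upwards [hlive'] with p hp
    show wilsonAction4 (c.Φ (x (s₀ + p.1), Function.extend β (fun c' => U₁ (β c')) (σ (y₁ + p.2)))) = _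
    rw [hΦbl _ _ _ hp]
  have hshift : ContDiffAt ℝ m (fun p : ℝ × EuclideanSpace ℝ (Fin dV) => wilsonAction4 (c.Φ (x (s₀ + p.1), σ (y₁ + p.2)))) 0 :=
    hmain.congr_of_eventuallyEq heq.symm
  have htr : ContDiffAt ℝ m (fun q : ℝ × EuclideanSpace ℝ (Fin dV) => ((q.1 - s₀ : ℝ), q.2 - y₁)) (s₀, y₁) :=
    (contDiffAt_fst.sub contDiffAt_const).prodMk (contDiffAt_snd.sub contDiffAt_const)
  have h0pt : (fun q : ℝ × EuclideanSpace ℝ (Fin dV) => ((q.1 - s₀ : ℝ), q.2 - y₁)) (s₀, y₁) = 0 := by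
    show ((s₀ - s₀ : ℝ), y₁ - y₁) = ((0 : ℝ), (0 : EuclideanSpace ℝ (Fin dV)))
    rw [sub_self, sub_self]
  have hshift' : ContDiffAt ℝ m (fun p : ℝ × EuclideanSpace ℝ (Fin dV) => wilsonAction4 (c.Φ (x (s₀ + p.1), σ (y₁ + p.2))))
      ((fun q : ℝ × EuclideanSpace ℝ (Fin dV) => ((q.1 - s₀ : ℝ), q.2 - y₁)) (s₀, y₁)) := by rw [h0pt]; exact hshift
  have hcomp := ContDiffAt.comp (s₀, y₁) hshift' htr
  refine hcomp.congr_of_eventuallyEq (Eventually.of_forall fun q => ?_)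
  simp only [Function.comp, add_sub_cancel]

/-- ★★★ **(C2″-WITHIN) — the same, with joint continuity of the chart asked only WITHIN THE LIVE GRAPH `{q | c.jac q ≠ 0}`** (the form w3-20520's CHART∞ chain
exports by projection, LEAD w3-20520 g16 2026-08-29 23:26Z «(j1)-WITHIN»); the re-centred path stays live, so the composition argument goes through `𝓝[live] (x s₀, U₁)`.
Conclusion:
`(s, y) ↦ A(c.Φ(x s, σ y))` is `C^m` at `(s₀, y₁)` — the `ContDiffAt ℝ 3` row of ✓`detRepA_edge`, for every `m`.
[cite: Balaban1987RG1, p.267 (after (2.10))] [cite: Balaban1985Variational, Thm 1 (8)-(10) p.279] [cite: Dieudonne1960, Ch. X §2 (10.2.1)–(10.2.3)] -/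
theorem contDiffAt_wilsonAction4_windowChart_param_within (hk : K - J ≤ (F.P K).m + (F.P K).K) {α : ℝ} (hα24 : α ≤ 1 / 24) (hαδ : α < deltaSU (Fin 2))
    (hαL : 157 * α < ((((F.P K).L : ℕ) : ℝ) ^ ((F.P K).d - 1))⁻¹) {θ : ℕ → ℝ} (hθ0 : ∀ i, 0 ≤ θ i)
    (hθα : ∀ i, ((((F.P K).d + 2) * (F.P K).L : ℕ) : ℝ) ^ 2 / 4 * θ i ≤ α)
    {Sf : Set (GaugeField (F.P K) 0 (Matrix.specialUnitaryGroup (Fin 2) ℂ))} {O : Set (GaugeField (F.P J) 0 (Matrix.specialUnitaryGroup (Fin 2) ℂ))}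
    (c : WindowChart F hJK Sf O)
    -- the smooth path of data
    (x : ℝ → GaugeField (F.P J) 0 (Matrix.specialUnitaryGroup (Fin 2) ℂ)) (s₀ : ℝ) (hxc : ContinuousAt x s₀)
    (hxs : ContDiffAt ℝ ⊤ (fun s => coeField (x s)) s₀)
    -- the transversal of the common tube
    (σ : EuclideanSpace ℝ (Fin dV) → GaugeField (F.P K) 0 (Matrix.specialUnitaryGroup (Fin 2) ℂ)) (hσc : Continuous σ)
    (hσs : ContDiff ℝ ⊤ (fun y : EuclideanSpace ℝ (Fin dV) => coeField (σ y))) (y₁ : EuclideanSpace ℝ (Fin dV))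
    -- chart clauses at every datum (✓`exists_laplaceRows` 1, 8, 6, 5)
    (hdesc : ∀ V z, c.jac (V, z) ≠ 0 → descendTo F ℰp J K hJK (c.Φ (V, z)) = V)
    (hoff : ∀ V z, c.jac (V, z) ≠ 0 → ∀ b, (∀ c', iterCentralBond (K - J) c' ≠ b) → c.Φ (V, z) b = z b)
    (hΦbl : ∀ V z (g : PBond (F.P K) (K - J) → Matrix.specialUnitaryGroup (Fin 2) ℂ), c.jac (V, z) ≠ 0 →
      c.Φ (V, Function.extend (iterCentralBond (K - J)) g z) = c.Φ (V, z))
    (hjbl : ∀ V z (g : PBond (F.P K) (K - J) → Matrix.specialUnitaryGroup (Fin 2) ℂ), c.jac (V, Function.extend (iterCentralBond (K - J)) g z) = c.jac (V, z))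
    -- the base data at `(s₀, y₁)`
    {U₁ : GaugeField (F.P K) 0 (Matrix.specialUnitaryGroup (Fin 2) ℂ)} (hU₁ : c.Φ (x s₀, σ y₁) = U₁) (hU₁h : U₁ ∈ histGood F ℰp θ K J)
    (hselfU₁ : c.Φ (x s₀, U₁) = U₁) (hlive : c.jac (x s₀, σ y₁) ≠ 0)
    (hcarrier : ∀ᶠ q in 𝓝 ((s₀ : ℝ), y₁), c.jac (x q.1, σ q.2) ≠ 0)
    (hΦjw : ContinuousWithinAt (fun q : GaugeField (F.P J) 0 (Matrix.specialUnitaryGroup (Fin 2) ℂ) × GaugeField (F.P K) 0 (Matrix.specialUnitaryGroup (Fin 2) ℂ) => c.Φ q)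
      {q | c.jac q ≠ 0} (x s₀, U₁))
    (m : WithTop ℕ∞) :
    ContDiffAt ℝ m (fun q : ℝ × EuclideanSpace ℝ (Fin dV) => wilsonAction4 (c.Φ (x q.1, σ q.2))) (s₀, y₁) := by
  classical
  set β := iterCentralBond (P := F.P K) (K - J) with hβ
  have hβi : Function.Injective β := iterCentralBond_injective (P := F.P K) hk
  -- descent of `U₁` and its guard
  have hU₁V : descendTo F ℰp J K hJK U₁ = x s₀ := by rw [← hU₁]; exact hdesc _ _ hlive
  have hhist := loopHist_le_of_mem_histGood F hθ0 hθα hU₁h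
  have hU₁small : SmallBelow (fun j => blockAvg (P := F.P K) (j := j) (expMeanLogSU (n := Fin 2))) (K - J) U₁ := smallBelow_of_loopHist_le hαδ hhist
  -- `U₁` agrees with `σ y₁` off the pivots
  have hU₁off : ∀ b, (∀ c', β c' ≠ b) → U₁ b = σ y₁ b := fun b hb => by rw [← hU₁]; exact hoff _ _ hlive b hb
  -- the re-centred transversal family `σ̂ p := (σ (y₁ + p.2)) with the pivots of U₁`
  set σh : ℝ × EuclideanSpace ℝ (Fin dV) → GaugeField (F.P K) 0 (Matrix.specialUnitaryGroup (Fin 2) ℂ) :=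
    fun p => Function.extend β (fun c' => U₁ (β c')) (σ (y₁ + p.2)) with hσh
  have hσh_piv : ∀ p c', σh p (β c') = U₁ (β c') := fun p c' => hβi.extend_apply _ _ c'
  have hσh_off : ∀ p b, (¬ ∃ c', β c' = b) → σh p b = σ (y₁ + p.2) b := fun p b hb => Function.extend_apply' _ _ b hb
  have hσh0 : σh 0 = U₁ := by
    show Function.extend β (fun c' => U₁ (β c')) (σ (y₁ + (0 : ℝ × EuclideanSpace ℝ (Fin dV)).2)) = U₁
    rw [Prod.snd_zero, add_zero]
    exact extend_pivots_eq_of_offPivot β hU₁off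
  have hσhc : Continuous σh := by
    refine continuous_pi fun b => ?_
    by_cases hb : ∃ c', β c' = b
    · obtain ⟨c', rfl⟩ := hb
      simp only [hσh_piv]; exact continuous_const
    · simp only [hσh_off _ b hb]
      exact (continuous_apply b).comp (hσc.comp (continuous_const.add continuous_snd))
  have hσhs : ContDiffAt ℝ ⊤ (fun p => coeField (σh p)) 0 := by
    refine contDiffAt_pi.2 fun b => ?_
    by_cases hb : ∃ c', β c' = b
    · obtain ⟨c', rfl⟩ := hb
      have : (fun p : ℝ × EuclideanSpace ℝ (Fin dV) => coeField (σh p) (β c')) = fun _ => ((U₁ (β c') : Matrix.specialUnitaryGroup (Fin 2) ℂ) : Matrix (Fin 2) (Fin 2) ℂ) := by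
        funext p; simp only [coeField, hσh_piv]
      rw [this]; exact contDiffAt_const
    · have : (fun p : ℝ × EuclideanSpace ℝ (Fin dV) => coeField (σh p) b) = fun p => coeField (σ (y₁ + p.2)) b := by
        funext p; simp only [coeField, hσh_off _ b hb]
      rw [this]
      have h1 : ContDiffAt ℝ ⊤ (fun p : ℝ × EuclideanSpace ℝ (Fin dV) => coeField (σ (y₁ + p.2))) 0 :=
        hσs.contDiffAt.comp 0 (contDiffAt_const.add contDiffAt_snd)
      exact (contDiffAt_pi.1 h1) b
  -- the moving coarse target
  set eJ := F.sitesPerDir_eq (m := F.m) (K := J) (j := 0) (m' := F.m) (K' := K) (j' := K - J) (by omega) with heJ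
  set T : ℝ × EuclideanSpace ℝ (Fin dV) → GaugeField (F.P K) (K - J) (Matrix.specialUnitaryGroup (Fin 2) ℂ) :=
    fun p => fieldShift eJ.symm (x (s₀ + p.1)) with hT
  have hiter_of_desc : ∀ U : GaugeField (F.P K) 0 (Matrix.specialUnitaryGroup (Fin 2) ℂ), ∀ V, descendTo F ℰp J K hJK U = V →
      Averaging.iter (fun j => blockAvg (P := F.P K) (j := j) (expMeanLogSU (n := Fin 2))) (K - J) U = fieldShift eJ.symm V := by
    intro U V h
    unfold descendTo at h
    rw [← h, fieldShift_fieldShift_symm]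
  have hT0 : T 0 = Averaging.iter (fun j => blockAvg (P := F.P K) (j := j) (expMeanLogSU (n := Fin 2))) (K - J) U₁ := by
    show fieldShift eJ.symm (x (s₀ + (0 : ℝ × EuclideanSpace ℝ (Fin dV)).1)) = _
    rw [Prod.fst_zero, add_zero, hiter_of_desc U₁ (x s₀) hU₁V]
  have hTs : ContDiffAt ℝ ⊤ (fun p => coeField (T p)) 0 := by
    have hx' : ContDiffAt ℝ ⊤ (fun p : ℝ × EuclideanSpace ℝ (Fin dV) => coeField (x (s₀ + p.1))) 0 := by
      have h0 : ContDiffAt ℝ ⊤ (fun s => coeField (x s)) (s₀ + (0 : ℝ × EuclideanSpace ℝ (Fin dV)).1) := by rw [Prod.fst_zero, add_zero]; exact hxs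
      exact ContDiffAt.comp (g := fun s => coeField (x s)) (f := fun p : ℝ × EuclideanSpace ℝ (Fin dV) => s₀ + p.1) 0 h0
        (contDiffAt_const.add contDiffAt_fst)
    refine contDiffAt_pi.2 fun b => ?_
    have : (fun p : ℝ × EuclideanSpace ℝ (Fin dV) => coeField (T p) b) = fun p => coeField (x (s₀ + p.1)) (bondShift eJ.symm b) := by
      funext p; simp only [coeField, hT, fieldShift_apply]
    rw [this]; exact (contDiffAt_pi.1 hx') _
  -- the family of charts
  set Φh : ℝ × EuclideanSpace ℝ (Fin dV) → GaugeField (F.P K) 0 (Matrix.specialUnitaryGroup (Fin 2) ℂ) → GaugeField (F.P K) 0 (Matrix.specialUnitaryGroup (Fin 2) ℂ) :=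
    fun p z => c.Φ (x (s₀ + p.1), z) with hΦh
  -- the path stays live, also after re-centring (jac is pivot-blind)
  have ht0 : Tendsto (fun p : ℝ × EuclideanSpace ℝ (Fin dV) => ((s₀ + p.1 : ℝ), y₁ + p.2)) (𝓝 0) (𝓝 (s₀, y₁)) := by
    have h := ((continuous_const.add continuous_fst).prodMk (continuous_const.add continuous_snd) :
      Continuous fun p : ℝ × EuclideanSpace ℝ (Fin dV) => ((s₀ + p.1 : ℝ), y₁ + p.2)).tendsto 0
    simpa using h
  have hlive' : ∀ᶠ p in 𝓝 (0 : ℝ × EuclideanSpace ℝ (Fin dV)), c.jac (x (s₀ + p.1), σ (y₁ + p.2)) ≠ 0 := ht0.eventually hcarrier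
  have hliveh : ∀ᶠ p in 𝓝 (0 : ℝ × EuclideanSpace ℝ (Fin dV)), c.jac (x (s₀ + p.1), σh p) ≠ 0 := by
    filter_upwards [hlive'] with p hp
    rwa [hσh, hjbl]
  -- (C2′) rows
  have hoff' : ∀ᶠ p in 𝓝 (0 : ℝ × EuclideanSpace ℝ (Fin dV)), ∀ b, (∀ c', iterCentralBond (K - J) c' ≠ b) → Φh p (σh p) b = σh p b := by
    filter_upwards [hliveh] with p hp b hb
    exact hoff _ _ hp b hb
  have hfib' : ∀ᶠ p in 𝓝 (0 : ℝ × EuclideanSpace ℝ (Fin dV)),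
      Averaging.iter (fun j => blockAvg (P := F.P K) (j := j) (expMeanLogSU (n := Fin 2))) (K - J) (Φh p (σh p)) = T p := by
    filter_upwards [hliveh] with p hp
    exact hiter_of_desc _ _ (hdesc _ _ hp)
  have hΦc' : ContinuousAt (fun p => Φh p (σh p)) 0 := by
    have hin : ContinuousAt (fun p : ℝ × EuclideanSpace ℝ (Fin dV) => (x (s₀ + p.1), σh p)) 0 := by
      refine ContinuousAt.prodMk ?_ hσhc.continuousAt
      have hx0 : ContinuousAt x (s₀ + (0 : ℝ × EuclideanSpace ℝ (Fin dV)).1) := by rw [Prod.fst_zero, add_zero]; exact hxc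
      exact ContinuousAt.comp (f := fun p : ℝ × EuclideanSpace ℝ (Fin dV) => s₀ + p.1) hx0 (continuousAt_const.add continuousAt_fst)
    have hbase : (fun p : ℝ × EuclideanSpace ℝ (Fin dV) => (x (s₀ + p.1), σh p)) 0 = (x s₀, U₁) := by
      show (x (s₀ + (0 : ℝ × EuclideanSpace ℝ (Fin dV)).1), σh 0) = _
      rw [Prod.fst_zero, add_zero, hσh0]
    -- the re-centred path tends to `(x s₀, U₁)` WITHIN the live graph
    have hinW : Tendsto (fun p : ℝ × EuclideanSpace ℝ (Fin dV) => (x (s₀ + p.1), σh p)) (𝓝 0)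
        (𝓝[{q : GaugeField (F.P J) 0 (Matrix.specialUnitaryGroup (Fin 2) ℂ) × GaugeField (F.P K) 0 (Matrix.specialUnitaryGroup (Fin 2) ℂ) | c.jac q ≠ 0}]
          (x s₀, U₁)) := by
      refine tendsto_nhdsWithin_iff.2 ⟨?_, hliveh.mono fun p hp => hp⟩
      have hbase' : (x (s₀ + (0 : ℝ × EuclideanSpace ℝ (Fin dV)).1), σh 0) = (x s₀, U₁) := by
        rw [Prod.fst_zero, add_zero, hσh0]
      have ht := hin.tendsto
      rwa [hbase'] at ht
    have hval : (fun p => Φh p (σh p)) 0 = c.Φ (x s₀, U₁) := by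
      show c.Φ (x (s₀ + (0 : ℝ × EuclideanSpace ℝ (Fin dV)).1), σh 0) = _
      rw [Prod.fst_zero, add_zero, hσh0]
    show Tendsto (fun p => Φh p (σh p)) (𝓝 0) (𝓝 ((fun p => Φh p (σh p)) 0))
    rw [hval]
    exact hΦjw.tendsto.comp hinW
  have hself' : Φh 0 U₁ = U₁ := by
    show c.Φ (x (s₀ + (0 : ℝ × EuclideanSpace ℝ (Fin dV)).1), U₁) = U₁
    rw [Prod.fst_zero, add_zero]; exact hselfU₁
  -- (C2-b) blocks at `U₁`
  have hR := contDiffAt_pivotRead_param (n := K - J) U₁ hU₁small σh hσhc hσh0 hσhs T hT0 hTs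
  have hinv := isInvertible_inr_param_of_blocks hk U₁ σh hσh0 T hT0 (hR.differentiableAt (by simp))
    (fun c' => ((chainRead_contDiffAt_surjective (P := F.P K) (N := 2) hα24 hαδ hαL hk U₁ c' hhist).2.1.differentiableAt (by simp)))
    (fun c' => isInvertible_fderiv_chainRead (P := F.P K) (N := 2) hα24 hαδ hαL hk U₁ c' hhist)
  -- (C2′)
  have hmain := contDiffAt_wilsonAction4_resolve_param (n := K - J) U₁ hU₁small σh hσhc hσh0 hσhs T hT0 hTs Φh hoff' hfib' hΦc' hself' hinv m
  -- undo the re-centring (the chart is pivot-blind) and translate to `(s₀, y₁)`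
  have heq : (fun p : ℝ × EuclideanSpace ℝ (Fin dV) => wilsonAction4 (Φh p (σh p))) =ᶠ[𝓝 0]
      fun p => wilsonAction4 (c.Φ (x (s₀ + p.1), σ (y₁ + p.2))) := by
    filter_upwards [hlive'] with p hp
    show wilsonAction4 (c.Φ (x (s₀ + p.1), Function.extend β (fun c' => U₁ (β c')) (σ (y₁ + p.2)))) = _
    rw [hΦbl _ _ _ hp]
  have hshift : ContDiffAt ℝ m (fun p : ℝ × EuclideanSpace ℝ (Fin dV) => wilsonAction4 (c.Φ (x (s₀ + p.1), σ (y₁ + p.2)))) 0 :=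
    hmain.congr_of_eventuallyEq heq.symm
  have htr : ContDiffAt ℝ m (fun q : ℝ × EuclideanSpace ℝ (Fin dV) => ((q.1 - s₀ : ℝ), q.2 - y₁)) (s₀, y₁) :=
    (contDiffAt_fst.sub contDiffAt_const).prodMk (contDiffAt_snd.sub contDiffAt_const)
  have h0pt : (fun q : ℝ × EuclideanSpace ℝ (Fin dV) => ((q.1 - s₀ : ℝ), q.2 - y₁)) (s₀, y₁) = 0 := by
    show ((s₀ - s₀ : ℝ), y₁ - y₁) = ((0 : ℝ), (0 : EuclideanSpace ℝ (Fin dV)))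
    rw [sub_self, sub_self]
  have hshift' : ContDiffAt ℝ m (fun p : ℝ × EuclideanSpace ℝ (Fin dV) => wilsonAction4 (c.Φ (x (s₀ + p.1), σ (y₁ + p.2))))
      ((fun q : ℝ × EuclideanSpace ℝ (Fin dV) => ((q.1 - s₀ : ℝ), q.2 - y₁)) (s₀, y₁)) := by rw [h0pt]; exact hshift
  have hcomp := ContDiffAt.comp (s₀, y₁) hshift' htr
  refine hcomp.congr_of_eventuallyEq (Eventually.of_forall fun q => ?_)
  simp only [Function.comp, add_sub_cancel]

end Summit.QuantumFields.YangMills.Theorems.FluctuationComparisonRegPrIntLS2BetaPeanoSmoothParam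

end
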